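import Mathlib.RingTheory.Polynomial.Cyclotomic.Basic
import Mathlib.RingTheory.Polynomial.Cyclotomic.Expand
import Mathlib.Tactic
import HarnessLib
import Summits.BirchSwinnertonDyer.BirchSwinnertonDyer.Theorems.Rank2ObservatoryMazurTateLayer

/-!
# BirchSwinnertonDyer — rank ≥ 2 observatory: the cyclotomic layer factors behind the signed
supersingular series (instrument U3-SS)

HONEST FRAMING: per-curve certified theorems and census instruments; no claim on BSD in rank ≥ 2.

The census instrument U3-SS (`SCHNEIDER-CENSUS.md` §3.9, `PREREG-U3SS.md`) builds, from the
level-`3ⁿ` plus-symbol tables `S_n(T) = Σ_b [b/3ⁿ]⁺ (1+T)^{i_b}` of a supersingular-at-`3` curve,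
the signed series `L⁺ = ±S_6 / (Φ_{3²}(1+T)·Φ_{3⁴}(1+T))`, `L⁻ = ±S_5 / (Φ_{3}(1+T)·Φ_{3³}(1+T))`
(Pollack, Duke Math. J. 118 (2003)) and Sprung's `L♯/L♭`, divides EXACTLY by these cyclotomic
layer factors, and its guard G5 identifies the `λ`-invariant of the quotient with the Mazur–Tate
table of U3-MTL: `λ(L♯₆) = λ_5 − 60`, `λ(L♭₆) = λ_4 − 20`, the offsets being Pollack–Weston's
`q_5 = 3⁴ − 3³ + 3² − 3`, `q_4 = 3³ − 3² + 3 − 1` (Duke Math. J. 156 (2011), Thm 4.1).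
The exact algebra behind the division structure and the offsets is recorded here, for every prime
`p`, in Mathlib's cyclotomic language:

* `nuLayer_eq_cyclotomic_comp` — the corestriction element `ν_n` of the U3-MTL leaf IS
  `Φ_{pⁿ}(X+1)`; hence `omegaLayer_succ_cyclotomic`: `ω_{n+1} = ω_n · Φ_{p^{n+1}}(X+1)`, i.e.
  `(X+1)^{pⁿ} − 1 = X · ∏_{k=1..n} Φ_{p^k}(X+1)` (`omegaLayer_eq_X_mul_prod`), the factorisation
  along which the symbol polynomials are divided.
* `cyclotomic_prime_pow_zmod_eq` / `cyclotomic_comp_X_add_one_zmod` — over `𝔽_p`,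
  `Φ_{p^k}(X+1) = X^{p^k − p^{k−1}}`, so dividing by a layer factor lowers the `X`-adic order
  (`λ`) of a mod-`p` image by exactly `φ(p^k)`.
* `signedOffsets_p3` — at `p = 3`: `Φ_3(X+1)Φ_27(X+1) ≡ X^20` and `Φ_9(X+1)Φ_81(X+1) ≡ X^60`
  (mod 3), and `20 = 3³ − 3² + 3 − 1`, `60 = 3⁴ − 3³ + 3² − 3` — the two offsets of guard G5.

Nothing here is specific to elliptic curves or asserts anything about a symbol table; which
series are divisible by which factors, and the `λ`-readings, are DATA in the census.
-/

open Polynomial Finset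

namespace Summit.BirchSwinnertonDyer.BirchSwinnertonDyer.Rank2Observatory

/-- The corestriction element of the U3-MTL leaf is the cyclotomic layer factor:
`ν_n = Φ_{pⁿ}(X+1)` (`n ≥ 1`, `p` prime). -/
theorem nuLayer_eq_cyclotomic_comp (p n : ℕ) (hp : p.Prime) (hn : 1 ≤ n) :
    nuLayer p n = (cyclotomic (p ^ n) ℤ).comp (X + 1) := by
  obtain ⟨m, rfl⟩ : ∃ m, n = m + 1 := ⟨n - 1, by omega⟩
  rw [cyclotomic_prime_pow_eq_geom_sum hp, Polynomial.sum_comp]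
  unfold nuLayer
  simp only [Nat.add_sub_cancel, pow_comp, X_comp]

/-- `ω_{n+1} = ω_n · Φ_{p^{n+1}}(X+1)` in `ℤ[X]`. -/
theorem omegaLayer_succ_cyclotomic (p n : ℕ) (hp : p.Prime) :
    omegaLayer p (n + 1) = omegaLayer p n * (cyclotomic (p ^ (n + 1)) ℤ).comp (X + 1) := by
  rw [← nuLayer_eq_cyclotomic_comp p (n + 1) hp (by omega)]
  exact omegaLayer_succ p n

/-- `(X+1)^{pⁿ} − 1 = X · ∏_{k=1..n} Φ_{p^k}(X+1)` — the layer factorisation along which the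
symbol polynomials of U3-SS are divided. -/
theorem omegaLayer_eq_X_mul_prod (p n : ℕ) (hp : p.Prime) :
    omegaLayer p n = X * ∏ k ∈ range n, (cyclotomic (p ^ (k + 1)) ℤ).comp (X + 1) := by
  induction n with
  | zero => simp [omegaLayer]
  | succ n ih => rw [omegaLayer_succ_cyclotomic p n hp, ih, Finset.prod_range_succ, mul_assoc]

/-- Over `𝔽_p`: `Φ_{p^k} = (X − 1)^{p^k − p^{k−1}}` (`k ≥ 1`). -/
theorem cyclotomic_prime_pow_zmod_eq (p k : ℕ) [hp : Fact p.Prime] (hk : 0 < k) :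
    cyclotomic (p ^ k) (ZMod p) = (X - 1) ^ (p ^ k - p ^ (k - 1)) := by
  have h := cyclotomic_mul_prime_pow_eq (ZMod p) (p := p) (m := 1)
    (Nat.Prime.not_dvd_one hp.out) hk
  rwa [mul_one, cyclotomic_one] at h

/-- Over `𝔽_p`: `Φ_{p^k}(X+1) = X^{p^k − p^{k−1}}` (`k ≥ 1`) — dividing a mod-`p` image by the
layer factor `Φ_{p^k}(1+T)` lowers its `X`-adic order by exactly `φ(p^k)`. -/
theorem cyclotomic_comp_X_add_one_zmod (p k : ℕ) [hp : Fact p.Prime] (hk : 0 < k) :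
    (cyclotomic (p ^ k) (ZMod p)).comp (X + 1) = X ^ (p ^ k - p ^ (k - 1)) := by
  rw [cyclotomic_prime_pow_zmod_eq p k hk, pow_comp, sub_comp, X_comp, one_comp,
    add_sub_cancel_right]

/-- Consistency with the U3-MTL leaf: reducing `ν_n = Φ_{pⁿ}(X+1)` mod `p` either way gives
`X^{pⁿ − p^{n−1}}`. -/
theorem nuLayer_map_zmod_eq_cyclotomic (p n : ℕ) [hp : Fact p.Prime] (hn : 1 ≤ n) :
    (nuLayer p n).map (Int.castRingHom (ZMod p)) =
      (cyclotomic (p ^ n) (ZMod p)).comp (X + 1) := by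
  rw [nuLayer_map_zmod p n hn, cyclotomic_comp_X_add_one_zmod p n (by omega)]

/-- The two offsets of guard G5 of U3-SS at `p = 3`: modulo 3,
`Φ_3(X+1)·Φ_27(X+1) = X^20` (odd layers `k = 1, 3`, the divisor of `S_5`, offset `q_4`) and
`Φ_9(X+1)·Φ_81(X+1) = X^60` (even layers `k = 2, 4`, the divisor of `S_6`, offset `q_5`), with
`q_4 = 3³ − 3² + 3 − 1 = 20` and `q_5 = 3⁴ − 3³ + 3² − 3 = 60` (Pollack–Weston's `q_n`). -/
theorem signedOffsets_p3 :
    ((cyclotomic (3 ^ 1) (ZMod 3)).comp (X + 1) * (cyclotomic (3 ^ 3) (ZMod 3)).comp (X + 1)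
        = X ^ 20) ∧
    ((cyclotomic (3 ^ 2) (ZMod 3)).comp (X + 1) * (cyclotomic (3 ^ 4) (ZMod 3)).comp (X + 1)
        = X ^ 60) ∧
    (3 ^ 3 - 3 ^ 2 + 3 - 1 = (20 : ℤ)) ∧ (3 ^ 4 - 3 ^ 3 + 3 ^ 2 - 3 = (60 : ℤ)) := by
  haveI : Fact (Nat.Prime 3) := ⟨by norm_num⟩
  refine ⟨?_, ?_, by norm_num, by norm_num⟩
  · rw [cyclotomic_comp_X_add_one_zmod 3 1 (by norm_num),
      cyclotomic_comp_X_add_one_zmod 3 3 (by norm_num), ← pow_add]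
    norm_num
  · rw [cyclotomic_comp_X_add_one_zmod 3 2 (by norm_num),
      cyclotomic_comp_X_add_one_zmod 3 4 (by norm_num), ← pow_add]
    norm_num

end Summit.BirchSwinnertonDyer.BirchSwinnertonDyer.Rank2Observatory
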